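import Summits.AtomisticToContinuum.FouriersLaw.Theorems.ContactStieltjesMeasureStieltjesRepresentationStubBoundaryGreenKuboAux1
import Summits.AtomisticToContinuum.FouriersLaw.Theorems.HonestZwanzigOrthogonalOhmDirichletBound
import Mathlib.Analysis.Calculus.LineDeriv.IntegrationByParts

/-!
# Stub `stub_pencilOfGreenKubo` of line `cayley-pencil` (crux `ContactStieltjesMeasure.StieltjesRepresentation`,
# stmt-AtomisticToContinuum-15248), part 2: the Gibbs adjoint of a momentum derivative

Helper file (`--supports stmt-AtomisticToContinuum-15248`). For the pinned anharmonic chain `P = pinnedChain ω₂ lam β γ`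
(`ω₂ > 0`, `lam, β ≥ 0`), `T > 0`, the Gibbs density `ρ = e^{-H/T}` and a momentum coordinate `p_i`:

* `integral_mul_partialP_mul_gibbsDensity` — **integration by parts against `e^{-H/T}` without compact support**:
  for `F, w ∈ C¹` with the three products integrable,
  `∫ F · ∂_{p_i} w · ρ = ∫ (-∂_{p_i}F + p_i F / T) · w · ρ`
  (Mathlib's `integral_bilinear_hasLineDerivAt_right_eq_neg_left_of_integrable` along `(0, e_i)`, with `f = Fρ`,
  `∂_{p_i}(Fρ) = (∂_{p_i}F - p_i F/T)ρ`). The operator `F ↦ -∂_{p_i}F + p_iF/T` is the `L²(μ_T)`-adjoint `∂_{p_i}†`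
  of `∂_{p_i}` (creation operator of the Ornstein–Uhlenbeck tap).
* `integral_mul_partialP_mul_gibbsDensity_nice` — the same for a NICE field `F` (`C^∞`, `|F|, |∂_{p_i}F| ≤ A e^{H/(16T)}`)
  against a smooth `w = O(e^{H/(8T)})` with `(∂_{p_i}w)² ρ ∈ L¹` (the class of the Poisson solutions of part 3), with
  the integrability of `F ∂_{p_i}w ρ` and of `(∂_{p_i}†F) w ρ`;
* `integral_adjointP_mul_gibbsDensity_eq_zero` — `∫ (∂_{p_i}†F) ρ = 0` (the case `w = 1`): `∂_{p_i}†F` is centred;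
* `abs_adjointP_le` — `∂_{p_i}†F` is a nice observable: `|√T(-∂_{p_i}F + p_iF/T)| ≤ A' e^{H/(8T)}`.
No definitions.
-/

noncomputable section

open MeasureTheory Filter Topology Set Function
open scoped ContDiff
open Literature.MathematicalPhysics.KineticTheory.HeatConduction

namespace Summit.AtomisticToContinuum.FouriersLaw.Theorems.ContactStieltjesMeasure.CayleyPencil

namespace Pencil

variable {N : ℕ}

/-! ### Integration by parts against the Gibbs density, integrable version -/

/-- **`∫ F ∂_{p_i}w e^{-H/T} = ∫ (-∂_{p_i}F + p_iF/T) w e^{-H/T}`** for an oscillator chain with `C¹` potentials,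
`F, w ∈ C¹` (the Hamiltonian need not even be differentiable beyond the momenta), provided `F ∂_{p_i}w ρ`, `(∂_{p_i}F - p_iF/T) w ρ` and `F w ρ` are integrable (no compact support).
[folklore] -/
theorem integral_mul_partialP_mul_gibbsDensity (P : OscillatorChain) (N : ℕ) (T : ℝ) (i : Fin N) {F w : PhaseSpace N → ℝ} (hF : ContDiff ℝ 1 F)
    (hw : ContDiff ℝ 1 w)
    (h1 : Integrable fun x => (partialP i F x - x.2 i * F x / T) * w x * P.gibbsDensity N T x)
    (h2 : Integrable fun x => F x * partialP i w x * P.gibbsDensity N T x)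
    (h3 : Integrable fun x => F x * w x * P.gibbsDensity N T x) :
    ∫ x, F x * partialP i w x * P.gibbsDensity N T x =
      ∫ x, (-partialP i F x + x.2 i * F x / T) * w x * P.gibbsDensity N T x := by
  haveI := isAddHaarMeasure_volume_phaseSpace N
  set ρ := P.gibbsDensity N T with hρ
  have hFd : Differentiable ℝ F := hF.differentiable one_ne_zero
  have hwd : Differentiable ℝ w := hw.differentiable one_ne_zero
  -- `∂_{p_i}(Fρ) = (∂_{p_i}F - p_i F / T) ρ`
  have hline : ∀ x : PhaseSpace N, HasLineDerivAt ℝ (fun y => F y * ρ y)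
      ((partialP i F x - x.2 i * F x / T) * ρ x) x ((0, Pi.single i 1) : PhaseSpace N) := by
    intro x
    have hρ' := P.hasLineDerivAt_gibbsDensity (T := T) (P.hasLineDerivAt_hamiltonian_unitP N x i)
    have hF' := hasLineDerivAt_partialP hFd i x
    unfold HasLineDerivAt at hρ' hF' ⊢
    have h := hF'.mul hρ'
    simp only [zero_smul, add_zero] at h
    refine h.congr_deriv ?_
    simp only [hρ]
    ring
  have key := integral_bilinear_hasLineDerivAt_right_eq_neg_left_of_integrable
    (μ := (volume : Measure (PhaseSpace N))) (B := ContinuousLinearMap.mul ℝ ℝ)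
    (f := fun y => F y * ρ y) (f' := fun x => (partialP i F x - x.2 i * F x / T) * ρ x)
    (g := w) (g' := partialP i w) (v := ((0, Pi.single i 1) : PhaseSpace N))
    (h1.congr (Eventually.of_forall fun x => by simp only [ContinuousLinearMap.mul_apply']; ring))
    (h2.congr (Eventually.of_forall fun x => by simp only [ContinuousLinearMap.mul_apply']; ring))
    (h3.congr (Eventually.of_forall fun x => by simp only [ContinuousLinearMap.mul_apply']; ring))
    (fun x _ => hline x) (fun x _ => hasLineDerivAt_partialP hwd i x)
  simp only [ContinuousLinearMap.mul_apply'] at key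
  calc ∫ x, F x * partialP i w x * ρ x = ∫ x, F x * ρ x * partialP i w x :=
        integral_congr_ae (Eventually.of_forall fun x => by ring)
    _ = -∫ x, (partialP i F x - x.2 i * F x / T) * ρ x * w x := key
    _ = ∫ x, (-partialP i F x + x.2 i * F x / T) * w x * ρ x := by
        rw [← integral_neg]
        exact integral_congr_ae (Eventually.of_forall fun x => by ring)

/-! ### Exponential-bound calculus at the exponents `1/(16T)` and `1/(8T)` -/

/-- `e^{H/(16T)} · e^{H/(16T)} = e^{H/(8T)}`. [folklore] -/
theorem exp_sixteen_mul_exp_sixteen (T H : ℝ) :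
    Real.exp (H / (16 * T)) * Real.exp (H / (16 * T)) = Real.exp (H / (8 * T)) := by
  rw [← Real.exp_add]; congr 1; ring

/-- `|p_i| ≤ 16T e^{H/(16T)}`... in the convenient form `|p_i| ≤ (1 + 16T) e^{H/(16T)}` (`|p_i| ≤ 1 + H`,
`H/(16T) ≤ e^{H/(16T)}`). [folklore] -/
theorem abs_momentum_le_exp_sixteen {ω₂ lam β : ℝ} (hω : 0 < ω₂) (hl : 0 ≤ lam) (hβ : 0 ≤ β) (γ : ℝ)
    {T : ℝ} (hT : 0 < T) (y : PhaseSpace N) (i : Fin N) :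
    |y.2 i| ≤ (1 + 16 * T) * Real.exp ((pinnedChain ω₂ lam β γ).hamiltonian N y / (16 * T)) := by
  set H := (pinnedChain ω₂ lam β γ).hamiltonian N y with hH
  have hconf := SubdiffusiveBondHeat.pinnedChain_isConfining (γ := 0) hω hl hβ le_rfl
  have hp : |y.2 i| ≤ 1 + H :=
    LinearResponseFTUR.abs_momentum_le_one_add hconf.U_nonneg hconf.V_nonneg y i
  have hH0 : 0 ≤ H := pinnedChain_hamiltonian_nonneg hω.le hl hβ γ N y
  have h1 : 1 ≤ Real.exp (H / (16 * T)) := Real.one_le_exp (by positivity)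
  have h2 : H / (16 * T) ≤ Real.exp (H / (16 * T)) := by
    have := Real.add_one_le_exp (H / (16 * T)); linarith
  have h3 : H ≤ 16 * T * Real.exp (H / (16 * T)) := by
    rw [div_le_iff₀ (by positivity)] at h2; linarith
  calc |y.2 i| ≤ 1 + H := hp
    _ ≤ Real.exp (H / (16 * T)) + 16 * T * Real.exp (H / (16 * T)) := by linarith
    _ = (1 + 16 * T) * Real.exp (H / (16 * T)) := by ring

/-- **`∂_{p_i}†F` is nice**: for `|F|, |∂_{p_i}F| ≤ A e^{H/(16T)}` (`A ≥ 0`, `T > 0`),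
`|√T(-∂_{p_i}F + p_i F/T)| ≤ √T·A·(1 + (1+16T)/T) · e^{H/(8T)}`. [folklore] -/
theorem abs_adjointP_le {ω₂ lam β : ℝ} (hω : 0 < ω₂) (hl : 0 ≤ lam) (hβ : 0 ≤ β) (γ : ℝ) {T : ℝ} (hT : 0 < T)
    (i : Fin N) {F : PhaseSpace N → ℝ} {A : ℝ} (hA : 0 ≤ A)
    (hFb : ∀ y, |F y| ≤ A * Real.exp ((pinnedChain ω₂ lam β γ).hamiltonian N y / (16 * T)))
    (hdFb : ∀ y, |partialP i F y| ≤ A * Real.exp ((pinnedChain ω₂ lam β γ).hamiltonian N y / (16 * T)))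
    (y : PhaseSpace N) :
    |Real.sqrt T * (-partialP i F y + y.2 i * F y / T)| ≤
      Real.sqrt T * A * (1 + (1 + 16 * T) / T) * Real.exp ((pinnedChain ω₂ lam β γ).hamiltonian N y / (8 * T)) := by
  set H := (pinnedChain ω₂ lam β γ).hamiltonian N y with hH
  have hH0 : 0 ≤ H := pinnedChain_hamiltonian_nonneg hω.le hl hβ γ N y
  have hp := abs_momentum_le_exp_sixteen hω hl hβ γ hT y i
  have he1 : 1 ≤ Real.exp (H / (16 * T)) := Real.one_le_exp (by positivity)
  have hee := exp_sixteen_mul_exp_sixteen T H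
  have hE0 : 0 ≤ Real.exp (H / (16 * T)) := (Real.exp_pos _).le
  rw [abs_mul, abs_of_nonneg (Real.sqrt_nonneg T)]
  have h1 : |-partialP i F y + y.2 i * F y / T| ≤
      A * Real.exp (H / (16 * T)) + (1 + 16 * T) * Real.exp (H / (16 * T)) * (A * Real.exp (H / (16 * T))) / T := by
    have e1 : |-partialP i F y + y.2 i * F y / T| ≤ |partialP i F y| + |y.2 i| * |F y| / T := by
      have h := abs_add_le (-partialP i F y) (y.2 i * F y / T)
      rw [abs_neg, abs_div, abs_mul, abs_of_pos hT] at h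
      exact h
    have e2 : |y.2 i| * |F y| ≤ (1 + 16 * T) * Real.exp (H / (16 * T)) * (A * Real.exp (H / (16 * T))) :=
      mul_le_mul hp (hFb y) (abs_nonneg _) (by positivity)
    have e3 : |y.2 i| * |F y| / T ≤ (1 + 16 * T) * Real.exp (H / (16 * T)) * (A * Real.exp (H / (16 * T))) / T :=
      div_le_div_of_nonneg_right e2 hT.le
    linarith [hdFb y]
  have h2 : A * Real.exp (H / (16 * T)) + (1 + 16 * T) * Real.exp (H / (16 * T)) * (A * Real.exp (H / (16 * T))) / T
      ≤ A * (1 + (1 + 16 * T) / T) * Real.exp (H / (8 * T)) := by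
    rw [← hee]
    have h3 : A * Real.exp (H / (16 * T)) ≤ A * (Real.exp (H / (16 * T)) * Real.exp (H / (16 * T))) := by
      refine mul_le_mul_of_nonneg_left ?_ hA
      calc Real.exp (H / (16 * T)) = Real.exp (H / (16 * T)) * 1 := (mul_one _).symm
        _ ≤ Real.exp (H / (16 * T)) * Real.exp (H / (16 * T)) := mul_le_mul_of_nonneg_left he1 hE0
    have h4 : (1 + 16 * T) * Real.exp (H / (16 * T)) * (A * Real.exp (H / (16 * T))) / T =
        A * ((1 + 16 * T) / T) * (Real.exp (H / (16 * T)) * Real.exp (H / (16 * T))) := by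
      field_simp
    rw [h4]
    nlinarith [h3, mul_nonneg (mul_nonneg hA (div_nonneg (by positivity : (0:ℝ) ≤ 1 + 16 * T) hT.le))
      (mul_nonneg hE0 hE0)]
  calc Real.sqrt T * |-partialP i F y + y.2 i * F y / T|
      ≤ Real.sqrt T * (A * (1 + (1 + 16 * T) / T) * Real.exp (H / (8 * T))) :=
        mul_le_mul_of_nonneg_left (h1.trans h2) (Real.sqrt_nonneg T)
    _ = _ := by ring

/-! ### The identity for nice fields against Poisson-class functions -/

section Pinned

variable {ω₂ lam β γ : ℝ} (hω : 0 < ω₂) (hl : 0 ≤ lam) (hβ : 0 ≤ β) {T : ℝ} (hT : 0 < T)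
include hω hl hβ hT

/-- **`∫ F ∂_{p_i}w ρ = ∫ (∂_{p_i}†F) w ρ` for a nice field against a Poisson-class function.** For the pinned chain,
`T > 0`, `F ∈ C^∞` with `|F|, |∂_{p_i}F| ≤ A e^{H/(16T)}`, `w ∈ C^∞` with `|w| ≤ K e^{H/(8T)}` and `(∂_{p_i}w)² ρ ∈ L¹`:
the products `F ∂_{p_i}w ρ` and `(-∂_{p_i}F + p_iF/T) w ρ` are integrable and
`∫ F ∂_{p_i}w ρ = ∫ (-∂_{p_i}F + p_iF/T) w ρ`. [folklore] -/
theorem integral_mul_partialP_mul_gibbsDensity_nice (i : Fin N) {F w : PhaseSpace N → ℝ} (hF : ContDiff ℝ ∞ F)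
    (hw : ContDiff ℝ ∞ w) {A K : ℝ} (hA : 0 ≤ A)
    (hFb : ∀ y, |F y| ≤ A * Real.exp ((pinnedChain ω₂ lam β γ).hamiltonian N y / (16 * T)))
    (hdFb : ∀ y, |partialP i F y| ≤ A * Real.exp ((pinnedChain ω₂ lam β γ).hamiltonian N y / (16 * T)))
    (hwb : ∀ y, |w y| ≤ K * Real.exp ((pinnedChain ω₂ lam β γ).hamiltonian N y / (8 * T)))
    (hdw : Integrable fun x => (partialP i w x) ^ 2 * (pinnedChain ω₂ lam β γ).gibbsDensity N T x) :
    Integrable (fun x => F x * partialP i w x * (pinnedChain ω₂ lam β γ).gibbsDensity N T x) ∧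
    Integrable (fun x => (-partialP i F x + x.2 i * F x / T) * w x * (pinnedChain ω₂ lam β γ).gibbsDensity N T x) ∧
    ∫ x, F x * partialP i w x * (pinnedChain ω₂ lam β γ).gibbsDensity N T x =
      ∫ x, (-partialP i F x + x.2 i * F x / T) * w x * (pinnedChain ω₂ lam β γ).gibbsDensity N T x := by
  set P := pinnedChain ω₂ lam β γ with hP
  set ρ := P.gibbsDensity N T with hρ
  set H := P.hamiltonian N with hH
  have hρc : Continuous ρ := pinnedChain_continuous_gibbsDensity ω₂ lam β γ N T
  have hρ0 : ∀ x, 0 ≤ ρ x := fun x => (P.gibbsDensity_pos N T x).le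
  have hFc : Continuous F := hF.continuous
  have hwc : Continuous w := hw.continuous
  have hdFc : Continuous (partialP i F) := continuous_partialP hF (by simp) i
  have hdwc : Continuous (partialP i w) := continuous_partialP hw (by simp) i
  have hpc : Continuous fun x : PhaseSpace N => x.2 i := (continuous_apply i).comp continuous_snd
  -- the adjoint field `a = √T(-∂F + pF/T)` is nice at `1/(8T)`; so is `F` itself
  have hadj := abs_adjointP_le hω hl hβ γ hT i hA hFb hdFb
  have hT' : Real.sqrt T ≠ 0 := (Real.sqrt_pos.2 hT).ne'
  set A' : ℝ := A * (1 + (1 + 16 * T) / T) with hA'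
  have hA'0 : 0 ≤ A' := by positivity
  have hab : ∀ y, |-partialP i F y + y.2 i * F y / T| ≤ A' * Real.exp (H y / (8 * T)) := by
    intro y
    have h := hadj y
    rw [abs_mul, abs_of_nonneg (Real.sqrt_nonneg T)] at h
    have hs : 0 < Real.sqrt T := Real.sqrt_pos.2 hT
    have : Real.sqrt T * |-partialP i F y + y.2 i * F y / T| ≤ Real.sqrt T * (A' * Real.exp (H y / (8 * T))) := by
      rw [hA']; linarith
    exact le_of_mul_le_mul_left this hs
  have hFb' : ∀ y, |F y| ≤ A * Real.exp (H y / (8 * T)) := by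
    intro y
    refine (hFb y).trans (mul_le_mul_of_nonneg_left ?_ hA)
    exact Real.exp_le_exp.2 (by
      have hH0 : 0 ≤ H y := pinnedChain_hamiltonian_nonneg hω.le hl hβ γ N y
      exact div_le_div_of_nonneg_left hH0 (by positivity) (by linarith))
  -- integrability: `(adjoint F) w ρ` and `F w ρ` by `integrable_weights`, `F ∂w ρ` by AM–GM
  have hgc : Continuous fun x : PhaseSpace N => -partialP i F x + x.2 i * F x / T :=
    hdFc.neg.add ((hpc.mul hFc).div_const T)
  obtain ⟨h1, -⟩ := HonestZwanzig.OrthogonalOhmLine.DirichletBound.integrable_weights (N := N) (γ := γ)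
    (w := w) (g := fun x => -partialP i F x + x.2 i * F x / T) hω hl hβ hT hwc hgc hwb hab
  obtain ⟨h3, -⟩ := HonestZwanzig.OrthogonalOhmLine.DirichletBound.integrable_weights (N := N) (γ := γ)
    (w := w) (g := F) hω hl hβ hT hwc hFc hwb hFb'
  have hF2 : Integrable fun x => F x ^ 2 * ρ x := by
    obtain ⟨h, -⟩ := HonestZwanzig.OrthogonalOhmLine.DirichletBound.integrable_weights (N := N) (γ := γ)
      (w := F) (g := F) hω hl hβ hT hFc hFc hFb' hFb'
    exact h.congr (Eventually.of_forall fun x => by ring)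
  have h2 : Integrable fun x => F x * partialP i w x * ρ x := by
    refine Integrable.mono' ((hF2.add hdw).div_const 2) ((hFc.mul hdwc).mul hρc).aestronglyMeasurable
      (Eventually.of_forall fun x => ?_)
    rw [Real.norm_eq_abs, abs_mul, abs_of_nonneg (hρ0 x)]
    have : |F x * partialP i w x| ≤ (F x ^ 2 + (partialP i w x) ^ 2) / 2 := by
      rw [abs_le]; constructor <;> nlinarith [sq_nonneg (F x - partialP i w x), sq_nonneg (F x + partialP i w x)]
    calc |F x * partialP i w x| * ρ x ≤ (F x ^ 2 + (partialP i w x) ^ 2) / 2 * ρ x :=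
          mul_le_mul_of_nonneg_right this (hρ0 x)
      _ = (F x ^ 2 * ρ x + (partialP i w x) ^ 2 * ρ x) / 2 := by ring
  have h1' : Integrable fun x => (partialP i F x - x.2 i * F x / T) * w x * ρ x := by
    refine (h1.neg).congr (Eventually.of_forall fun x => ?_)
    simp only [Pi.neg_apply]; ring
  refine ⟨h2, h1, ?_⟩
  exact integral_mul_partialP_mul_gibbsDensity P N T i (hF.of_le (by exact_mod_cast le_top))
    (hw.of_le (by exact_mod_cast le_top)) h1' h2 h3

/-- **`∂_{p_i}†F` is centred**: `∫ (-∂_{p_i}F + p_iF/T) ρ = 0` for a nice field `F` (the identity with `w = 1`).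
[folklore] -/
theorem integral_adjointP_mul_gibbsDensity_eq_zero (i : Fin N) {F : PhaseSpace N → ℝ} (hF : ContDiff ℝ ∞ F)
    {A : ℝ} (hA : 0 ≤ A)
    (hFb : ∀ y, |F y| ≤ A * Real.exp ((pinnedChain ω₂ lam β γ).hamiltonian N y / (16 * T)))
    (hdFb : ∀ y, |partialP i F y| ≤ A * Real.exp ((pinnedChain ω₂ lam β γ).hamiltonian N y / (16 * T))) :
    Integrable (fun x => (-partialP i F x + x.2 i * F x / T) * (pinnedChain ω₂ lam β γ).gibbsDensity N T x) ∧
    ∫ x, (-partialP i F x + x.2 i * F x / T) * (pinnedChain ω₂ lam β γ).gibbsDensity N T x = 0 := by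
  have h1 : ∀ y : PhaseSpace N, |(1 : ℝ)| ≤ 1 * Real.exp ((pinnedChain ω₂ lam β γ).hamiltonian N y / (8 * T)) := by
    intro y
    rw [abs_one, one_mul]
    exact Real.one_le_exp (div_nonneg (pinnedChain_hamiltonian_nonneg hω.le hl hβ γ N y) (by positivity))
  have hd1 : ∀ x : PhaseSpace N, partialP i (fun _ : PhaseSpace N => (1 : ℝ)) x = 0 := fun x => by
    simp [partialP]
  have hint : Integrable fun x => (partialP i (fun _ : PhaseSpace N => (1 : ℝ)) x) ^ 2 *
      (pinnedChain ω₂ lam β γ).gibbsDensity N T x := by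
    refine (integrable_zero _ _ _).congr (Eventually.of_forall fun x => ?_)
    simp [hd1 x]
  obtain ⟨-, hI, hEq⟩ := integral_mul_partialP_mul_gibbsDensity_nice hω hl hβ hT i hF contDiff_const hA
    hFb hdFb h1 hint
  simp only [hd1, mul_zero, zero_mul, integral_zero, mul_one] at hEq hI
  exact ⟨hI, hEq.symm⟩

end Pinned

end Pencil

/-! ## Registered helper stub -/

open Pencil in
/-- **Registered sub-goal `stub_pencilOfGreenKubo_gibbsIBP`** of the crux (this file's ticket): the Gibbs integration by
parts for nice fields against Poisson-class functions (= `Pencil.integral_mul_partialP_mul_gibbsDensity_nice`).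
[folklore] -/
theorem stub_pencilOfGreenKubo_gibbsIBP :
    ∀ (N : ℕ) (ω₂ lam β γ : ℝ), 0 < ω₂ → 0 ≤ lam → 0 ≤ β → ∀ (T : ℝ), 0 < T → ∀ (i : Fin N) (F w : Literature.MathematicalPhysics.KineticTheory.HeatConduction.PhaseSpace N → ℝ), ContDiff ℝ ((⊤ : ℕ∞) : WithTop ℕ∞) F → ContDiff ℝ ((⊤ : ℕ∞) : WithTop ℕ∞) w → ∀ (A K : ℝ), 0 ≤ A → (∀ y, |F y| ≤ A * Real.exp ((Literature.MathematicalPhysics.KineticTheory.HeatConduction.pinnedChain ω₂ lam β γ).hamiltonian N y / (16 * T))) → (∀ y, |Literature.MathematicalPhysics.KineticTheory.HeatConduction.partialP i F y| ≤ A * Real.exp ((Literature.MathematicalPhysics.KineticTheory.HeatConduction.pinnedChain ω₂ lam β γ).hamiltonian N y / (16 * T))) → (∀ y, |w y| ≤ K * Real.exp ((Literature.MathematicalPhysics.KineticTheory.HeatConduction.pinnedChain ω₂ lam β γ).hamiltonian N y / (8 * T))) → MeasureTheory.Integrable (fun x => (Literature.MathematicalPhysics.KineticTheory.HeatConduction.partialP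 i w x) ^ 2 * (Literature.MathematicalPhysics.KineticTheory.HeatConduction.pinnedChain ω₂ lam β γ).gibbsDensity N T x) → MeasureTheory.Integrable (fun x => F x * Literature.MathematicalPhysics.KineticTheory.HeatConduction.partialP i w x * (Literature.MathematicalPhysics.KineticTheory.HeatConduction.pinnedChain ω₂ lam β γ).gibbsDensity N T x) ∧ MeasureTheory.Integrable (fun x => (-Literature.MathematicalPhysics.KineticTheory.HeatConduction.partialP i F x + x.2 i * F x / T) * w x * (Literature.MathematicalPhysics.KineticTheory.HeatConduction.pinnedChain ω₂ lam β γ).gibbsDensity N T x) ∧ ∫ x, F x * Literature.MathematicalPhysics.KineticTheory.HeatConduction.partialP i w x * (Literature.MathematicalPhysics.KineticTheory.HeatConduction.pinnedChain ω₂ lam β γ).gibbsDensity N T x = ∫ x, (-Literature.MathematicalPhysics.KineticTheory.HeatConduction.partialP i F x + x.2 i * F x / T) * w x * (Literature.MathematicalPhysics.KineticTheory.HeatConduction.pinnedChain ω₂ lam β γ).gibbsDensity N T x :=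
  fun _ _ _ _ _ hω hl hβ _ hT i _ _ hF hw _ _ hA hFb hdFb hwb hdw =>
    integral_mul_partialP_mul_gibbsDensity_nice hω hl hβ hT i hF hw hA hFb hdFb hwb hdw

end Summit.AtomisticToContinuum.FouriersLaw.Theorems.ContactStieltjesMeasure.CayleyPencil

end
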